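import Summits.RiemannHypothesis.RiemannHypothesis.Theorems.WeilFormatCDataLog3HalfFrontData
import HarnessLib

/-!
# Format C kernel rung `Log3Half` (a = (log 3)/2): (P) the dyadic-Cholesky PSD verdicts on the even and odd Schur data `DS` (kernel certificates, n = 25 / 24)

Window `a = (log 3)/2`; prime powers in the window: 2; evaluator parameters S = 2^80, Kpi 70, Kser 96, kred 8, Kexp 24, J 60; full table modes < 34; light column table modes < 131; units 2^-80 (entries), 2^-40 (weights).
Generated by rh-explicit-weil-2 gen5 (gen/gramgen.py + emit5.py) from `#eval` of the tree's `Encl` functions; every datum is re-verified by the kernel in the theorem files (`decide +kernel`: recompute + containment). Helper data of the rh-explicit Weil-positivity programme (format C, K-CELL-2 CAL rung), RH-free. [cite: Yoshida1992HermitianForms, §5 (5.15)-(5.16) p. 301; §7 pp. 305–312]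
-/

set_option linter.dupNamespace false
set_option maxRecDepth 200000

namespace Summit.RiemannHypothesis.RiemannHypothesis.Theorems.WeilFormatCData.Log3HalfEvenFront

open Literature.NumberTheory.LFunctions

/-- **(P)**: `PsdDyadic.checkPsdMid 25 δ ρP DS L` — `DS − δ·1 ⪰` the Cholesky rounding budget, hence every real symmetric
matrix within `ρP`·2^-80 of `DS`·2^-80 entrywise is PSD (`PsdDyadic.psd_of_checkPsdMid`). [folklore] -/
theorem checkPsdMid_holds : PsdDyadic.checkPsdMid 25 δ ρP DS L = true := by
  decide +kernel

end Summit.RiemannHypothesis.RiemannHypothesis.Theorems.WeilFormatCData.Log3HalfEvenFront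

namespace Summit.RiemannHypothesis.RiemannHypothesis.Theorems.WeilFormatCData.Log3HalfOddFrontW

open Literature.NumberTheory.LFunctions

/-- **(P)**: `PsdDyadic.checkPsdMid 24 δ ρP DS L` — `DS − δ·1 ⪰` the Cholesky rounding budget, hence every real symmetric
matrix within `ρP`·2^-80 of `DS`·2^-80 entrywise is PSD (`PsdDyadic.psd_of_checkPsdMid`). [folklore] -/
theorem checkPsdMid_holds : PsdDyadic.checkPsdMid 24 δ ρP DS L = true := by
  decide +kernel

end Summit.RiemannHypothesis.RiemannHypothesis.Theorems.WeilFormatCData.Log3HalfOddFrontW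

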